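import Literature.MeasureTheory.Group.InvariantQuotientNormalized
import HarnessLib

/-!
# The invariant quotient measure by a COMPACT subgroup: `ρ(H) · μ_{G/H} = π_* ν`
(Folland, *A Course in Abstract Harmonic Analysis* (1995), Thm. 2.49 and (2.52); Deitmar–Echterhoff,
*Principles of Harmonic Analysis* (2014), Thm. 1.5.3; Bourbaki, *Intégration* VII §2 no. 8)

Topic `MeasureTheory/Group`; namespace `Literature.MeasureTheory.Group`.  THEOREMS ONLY (no definition, no named fact,
no instance, no notation, no `sorry`); imports ★ `InvariantQuotientNormalized` (Weil's formula with constant ONE for the tree's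
quotient measure, `lintegral_fiberLIntegral_quotientMeasure`).  Cell `pub/hodgecm-mathlib`, F0∕P3a, seat F0P3a-p08 (g11); LEAD DESK
WORD T6-67: part (1) of the brick «D1′c» (the MEASURE side of road D1′ at the DEFINITE archimedean places) of the #88 repair census
`F0/P3a/F0P3a-p05/g9/SIZING-S1prime.v2.F0P3a-p05g9.md` §2 (κ-arch) (iii) ∕ `CENSUS-88-arch.v2` §5 («compact group: orbital integral =
continuous average»).  Part (2) `Automorphic/CompactGroupOrbitalIntegral` applies it to orbital integrals on a compact group.

THE MATHEMATICS.  Let `G` be a locally compact second countable Hausdorff group with a right Haar measure `ν`, `H ≤ G` a closed subgroup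
with a left-invariant, inversion-invariant, open-positive measure `ρ` finite on compact sets, `ν` a Haar measure, and `μ_{G/H} = quotientMeasure H ρ hH ν` the tree's invariant
quotient measure (★ `InvariantQuotientExistence`), characterised by Weil's formula `∫_{G/H} (∫_H f(g h) dρ) dμ_{G/H} = ∫_G f dν` (★
`lintegral_fiberLIntegral_quotientMeasure`).  For a function `F` on `G ⧸ H` the fibre integral of `F ∘ π` is `ρ(H) · F` (`fiberLIntegral_comp_mk_apply_eq_measure_univ_mul`),
so Weil's formula at `f = F ∘ π` reads
  `ρ(H) · ∫_{G/H} F dμ_{G/H} = ∫_G F(π g) dν(g)`            (`measure_univ_mul_lintegral_quotientMeasure`),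
i.e. `ρ(H) • μ_{G/H} = π_* ν` as measures (`measure_univ_smul_quotientMeasure_eq_map_mk`).  When `H` is COMPACT (`0 < ρ(H) < ∞` for an
open-positive `ρ`): `μ_{G/H} = ρ(H)⁻¹ • π_* ν` (`quotientMeasure_eq_inv_smul_map_mk`), `∫_{G/H} F dμ_{G/H} = ρ(H)⁻¹ ∫_G F ∘ π dν` for Borel
`F ≥ 0` (`lintegral_quotientMeasure_eq_inv_mul`) and for Bochner integrands (`integral_quotientMeasure_eq_inv_smul`).  The factor `ρ(H)` is kept
VISIBLE: it is the «compatible measures» datum of [Rogawski1990 §1.7 p. 6, §14.5 p. 239] at a compact centraliser.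
HONEST LABEL: HC_CM is proved only modulo the printed citations until rung 0 closes; count-neutral generic brick (no stub closes).

## References
* [Folland1995] G. B. Folland, *A Course in Abstract Harmonic Analysis* (1995), §2.6 Thm. 2.49, (2.52).
* [DeitmarEchterhoff2014] A. Deitmar, S. Echterhoff, *Principles of Harmonic Analysis*, 2nd ed. (2014), Thm. 1.5.3, Cor. 1.5.4.
* [Rogawski1990] J. D. Rogawski, *Automorphic Representations of Unitary Groups in Three Variables* (1990), §1.7 p. 6, §14.5 p. 239.
-/

set_option autoImplicit false

noncomputable section

open _root_.MeasureTheory _root_.MeasureTheory.Measure _root_.Topology Set Filter Function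
open scoped ENNReal NNReal Pointwise

-- The coset space carries the Borel σ-algebra supplied by the binders `[MeasurableSpace (G ⧸ H)] [BorelSpace (G ⧸ H)]` (local
-- instances take precedence over Mathlib's quotient σ-algebra instance), as in ★ `InvariantQuotientNormalized`.

namespace Literature.MeasureTheory.Group

/-! ## §1 The fibre integral of a function constant on the cosets -/

section Fiber

variable {G : Type*} [Group G] [TopologicalSpace G] [IsTopologicalGroup G] [MeasurableSpace G] [BorelSpace G]
  (H : Subgroup G) (ρ : Measure H) [ρ.IsMulLeftInvariant]

/-- **`(F ∘ π)^H = ρ(H) · F`**: the fibre integral of a function pulled back from `G ⧸ H` is the constant multiple `ρ(H) · F`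
(the case `f = 1` of ★ `fiberLIntegral_mul_comp_mk`). [cite: Folland1995, §2.6 (2.52)] -/
theorem fiberLIntegral_comp_mk_apply_eq_measure_univ_mul (F : G ⧸ H → ℝ≥0∞) (x : G ⧸ H) :
    fiberLIntegral H ρ (F ∘ (QuotientGroup.mk : G → G ⧸ H)) x = ρ Set.univ * F x := by
  induction x using QuotientGroup.induction_on with
  | H g =>
    rw [fiberLIntegral_mk]
    have h1 : (fun h : H => (F ∘ (QuotientGroup.mk : G → G ⧸ H)) (g * h)) = fun _ : H => F (QuotientGroup.mk g) := by
      funext h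
      simp only [Function.comp_apply, QuotientGroup.mk_mul_of_mem g h.2]
    rw [h1, lintegral_const, mul_comm]

end Fiber

/-! ## §2 Weil's formula at `F ∘ π`: `ρ(H) · μ_{G/H} = π_* ν` -/

section Compact

variable {G : Type*} [Group G] [TopologicalSpace G] [IsTopologicalGroup G] [LocallyCompactSpace G]
  [SecondCountableTopology G] [T2Space G] [MeasurableSpace G] [BorelSpace G]
  (H : Subgroup G) [hH : IsClosed (H : Set G)]
  (ρ : Measure H) [ρ.IsMulLeftInvariant] [IsFiniteMeasureOnCompacts ρ] [ρ.IsOpenPosMeasure] [SFinite ρ] [ρ.IsInvInvariant]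
  (ν : Measure G) [IsHaarMeasure ν] [ν.IsMulRightInvariant]
  [MeasurableSpace (G ⧸ H)] [BorelSpace (G ⧸ H)]

/-- **`ρ(H) · ∫_{G/H} F dμ_{G/H} = ∫_G F(π g) dν(g)`** for every Borel `F : G ⧸ H → [0, ∞]` (Weil's formula with constant one, ★
`lintegral_fiberLIntegral_quotientMeasure`, at the pulled-back function `F ∘ π`). [cite: Folland1995, §2.6 Thm. 2.49 and (2.52)]
[cite: DeitmarEchterhoff2014, Thm. 1.5.3] -/
theorem measure_univ_mul_lintegral_quotientMeasure {F : G ⧸ H → ℝ≥0∞} (hF : Measurable F) :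
    ρ Set.univ * ∫⁻ x, F x ∂quotientMeasure H ρ hH ν = ∫⁻ g, F (QuotientGroup.mk g) ∂ν := by
  have hFm : Measurable (F ∘ (QuotientGroup.mk : G → G ⧸ H)) := hF.comp QuotientGroup.continuous_mk.measurable
  have h := lintegral_fiberLIntegral_quotientMeasure H ρ ν hFm
  simp_rw [fiberLIntegral_comp_mk_apply_eq_measure_univ_mul H ρ F] at h
  rw [lintegral_const_mul _ hF] at h
  exact h

/-- **`ρ(H) • μ_{G/H} = π_* ν`**: the `ρ(H)`-multiple of the invariant quotient measure is the image of the Haar measure `ν` under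
`π : G → G ⧸ H`. [cite: Folland1995, §2.6 (2.52)] [cite: DeitmarEchterhoff2014, Thm. 1.5.3] -/
theorem measure_univ_smul_quotientMeasure_eq_map_mk :
    ρ Set.univ • quotientMeasure H ρ hH ν = Measure.map (QuotientGroup.mk : G → G ⧸ H) ν := by
  refine Measure.ext fun s hs => ?_
  rw [Measure.smul_apply, smul_eq_mul, Measure.map_apply QuotientGroup.continuous_mk.measurable hs, ← lintegral_indicator_one hs,
    measure_univ_mul_lintegral_quotientMeasure H ρ ν (measurable_one.indicator hs),
    ← lintegral_indicator_one (QuotientGroup.continuous_mk.measurable hs)]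
  exact lintegral_congr fun g => rfl

variable [CompactSpace H]

omit [IsTopologicalGroup G] [LocallyCompactSpace G] [SecondCountableTopology G] [T2Space G] [BorelSpace G] hH [ρ.IsMulLeftInvariant]
  [IsFiniteMeasureOnCompacts ρ] [SFinite ρ] [ρ.IsInvInvariant] [IsHaarMeasure ν] [ν.IsMulRightInvariant]
  [MeasurableSpace (G ⧸ H)] [BorelSpace (G ⧸ H)] [CompactSpace H] in
/-- `ρ(H) ≠ 0` for an open-positive `ρ` (the subgroup is non-empty). [folklore] -/
private theorem measure_univ_ne_zero_of_isOpenPosMeasure : ρ Set.univ ≠ 0 :=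
  (isOpen_univ.measure_pos ρ univ_nonempty).ne'

omit [IsTopologicalGroup G] [LocallyCompactSpace G] [SecondCountableTopology G] [T2Space G] [BorelSpace G] hH [ρ.IsMulLeftInvariant]
  [ρ.IsOpenPosMeasure] [SFinite ρ] [ρ.IsInvInvariant] [IsHaarMeasure ν] [ν.IsMulRightInvariant]
  [MeasurableSpace (G ⧸ H)] [BorelSpace (G ⧸ H)] in
/-- `ρ(H) < ∞` for a compact `H` and `ρ` finite on compact sets. [folklore] -/
private theorem measure_univ_lt_top_of_compactSpace : ρ Set.univ < ⊤ :=
  isCompact_univ.measure_lt_top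

/-- **COMPACT SUBGROUP: `μ_{G/H} = ρ(H)⁻¹ • π_* ν`** — the invariant quotient measure by a compact subgroup is the image of Haar measure,
normalised by the total mass of the subgroup measure. [cite: Folland1995, §2.6 Thm. 2.49 and (2.52)] [cite: DeitmarEchterhoff2014, Cor. 1.5.4] -/
theorem quotientMeasure_eq_inv_smul_map_mk :
    quotientMeasure H ρ hH ν = (ρ Set.univ)⁻¹ • Measure.map (QuotientGroup.mk : G → G ⧸ H) ν := by
  rw [← measure_univ_smul_quotientMeasure_eq_map_mk H ρ ν, smul_smul,
    ENNReal.inv_mul_cancel (measure_univ_ne_zero_of_isOpenPosMeasure H ρ) (measure_univ_lt_top_of_compactSpace H ρ).ne, one_smul]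

/-- **`∫_{G/H} F dμ_{G/H} = ρ(H)⁻¹ ∫_G F(π g) dν(g)`** for Borel `F : G ⧸ H → [0, ∞]`, `H` compact. [cite: Folland1995, §2.6 (2.52)] -/
theorem lintegral_quotientMeasure_eq_inv_mul {F : G ⧸ H → ℝ≥0∞} (hF : Measurable F) :
    ∫⁻ x, F x ∂quotientMeasure H ρ hH ν = (ρ Set.univ)⁻¹ * ∫⁻ g, F (QuotientGroup.mk g) ∂ν := by
  rw [quotientMeasure_eq_inv_smul_map_mk H ρ ν, lintegral_smul_measure, smul_eq_mul,
    lintegral_map hF QuotientGroup.continuous_mk.measurable]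

/-- **Bochner form: `∫_{G/H} F dμ_{G/H} = ρ(H)⁻¹ • ∫_G F(π g) dν(g)`** for strongly measurable `F : G ⧸ H → E`, `H` compact (`ρ(H)⁻¹` read in
`ℝ` as `(ρ.real univ)⁻¹`). [cite: Folland1995, §2.6 (2.52)] [cite: DeitmarEchterhoff2014, Cor. 1.5.4] -/
theorem integral_quotientMeasure_eq_inv_smul {E : Type*} [NormedAddCommGroup E] [NormedSpace ℝ E] (F : G ⧸ H → E)
    (hF : StronglyMeasurable F) :
    ∫ x, F x ∂quotientMeasure H ρ hH ν = (ρ.real Set.univ)⁻¹ • ∫ g, F (QuotientGroup.mk g) ∂ν := by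
  rw [quotientMeasure_eq_inv_smul_map_mk H ρ ν, integral_smul_measure,
    integral_map QuotientGroup.continuous_mk.measurable.aemeasurable hF.aestronglyMeasurable, Measure.real, ENNReal.toReal_inv]

end Compact

end Literature.MeasureTheory.Group

end
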